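import Summits.BirchSwinnertonDyer.BirchSwinnertonDyer.Theorems.RamifiedHeegnerPairLeafPartnerGenusBottom
import Literature.NumberTheory.EllipticCurves.RingClassGalOverCardinality
import Literature.NumberTheory.ComplexMultiplication.CMLatticeRingClassTowerGaloisDegrees
import Mathlib.FieldTheory.Galois.Basic
import HarnessLib

/-!
# Crux U₁ `LeafRankOneUpperAtThree` (stmt-BirchSwinnertonDyer-26022) ∕ U₀ (26024), line `partnerdescent` — partner kernel part 15:
# the GENUS INVOLUTION `σ_m` of `K[3m]/K[m]` and the LEVEL-`m` DESCENT `D_m ∈ W(K[m])` of `ψ_θ((1 − σ_m)·y(3m))`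

HONEST FRAMING (lead prover `bsd-line-rhp-p2` g58, explicit-unit seat, cell `bsd-wall`): a SUPPORT file (`--supports 26022 --as helper`)
for the registered stub (DISPLAY-L) `stub_partnerGenusDisplayLabelledAtThree`. It proves NO stub and closes NO item; BSD is proved for no
curve. Theorems only; no definition, no named fact, no `sorry`.

WHAT. The labelled `W`-family of (DISPLAY-L) is, level by level, `ys(m) = c·χ₋₃(m)·D_m` where `D_m ∈ W(K[m])` descends
`ψ_θ((1 − σ_m)·y(3m))`, `y(3m) ∈ V(K[3m])` the conductor-`3m` CM point of the typed fact `shimuraCurve_heegnerSystem_genusThree`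
and `σ_m` the non-trivial element of `Gal(K[3m]/K[m])` (order `2`, `σ_m √−3 = −√−3`). This file builds that level-`m` step from TREE
THEOREMS ONLY (no class field theory is assumed: genus theory and the ring class degrees are proved in the tree):
* §1 `sqrt_negThree_mem` ∕ `sqrt_negThree_not_mem` — `√−3 ∈ K[3m]`, `√−3 ∉ K[m]` (`3 ∤ m`, `3 ∤ d_K`):
  `sqrt_intCast_mem_ringClassField` ∕ `sqrt_intCast_not_mem_ringClassField` (Cohn ∕ Cox genus theory, PROVED in the tree).
* §2 `card_ringClassGalOver_three_mul` — `#Gal(K[3m]/K[m]) = 2` for `3` split in `K`, `3 ∤ m`, `d_K < −4`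
  (`card_ringClassGalOver_eq_finrank_subfieldIn` + `finrank_subfieldIn_prime_mul_of_split`: `[K[3m]:K[m]] = 3 − (d_K/3) = 2`).
* §3 `exists_genusInvolution` — THERE IS `σ ∈ Gal(K[3m]/K[m])` with `σ θ = −θ` for every `θ ∈ K[3m]`, `θ² = −3`, `σ² = 1`, and
  `Gal(K[3m]/K[m]) = {1, σ}` (if every element fixed `θ`, the Galois correspondence for `K[3m]/K` would put `θ` in `K[m]`).
* §4 `exists_genusDescent_level` — for `y ∈ V(K[3m])`: THERE IS `D ∈ W(K[m])` with `D↑K[3m] = ψ_θ(y − σ·y)` (part 10's Galois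
  descent over the quadratic Galois extension `K[3m]/K[m]`, whose two automorphisms are `1` — fixing `θ` and `z` — and `σ` — negating both).
[cite: GrossLMS1991, §3 (p. 216: the tower), §4 (4.1)] [cite: Cox2013, §7.D Thm. 7.24, §9.A] [cite: SilvermanAEC2009, X.5 Cor. 5.4 (iii), VIII.§1]
[cite: CoatesLiTianZhai2015, Lemma 2.7] presearch: «genus subfield K(√−3) of the ring class field of conductor 3; descent of χ-components to the
twist» → [corpus:arxiv-1312.3884 Lemma 2.7] (CLTZ: `K(√q) ⊂ H_q` by degree + ramification — the argument of §3 here); tree: genus theory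
PROVED (`RingClassFieldGenusProofs`), degrees PROVED (`CMLatticeRingClassTowerGaloisDegrees`); nothing restated (corpus+galaxy).
-/

set_option linter.dupNamespace false
set_option autoImplicit false

noncomputable section

open scoped Classical

namespace Summit.BirchSwinnertonDyer.BirchSwinnertonDyer.Theorems.LeafPartnerGenusLevel

open WeierstrassCurve NumberField Module Literature.NumberTheory.EllipticCurves
  Literature.NumberTheory.EllipticCurves.RingClassField
  Literature.NumberTheory.ComplexMultiplication.CMTypeLattice
  Summit.BirchSwinnertonDyer.BirchSwinnertonDyer.Theorems.LeafPartnerGenusTransport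
  Summit.BirchSwinnertonDyer.BirchSwinnertonDyer.Theorems.LeafPartnerGenusBottom

variable {K : Type} [Field K] [NumberField K]

/-! ## §1 `√−3 ∈ K[3m]`, `√−3 ∉ K[m]` -/

/-- **`√−3 ∈ K[3m]`** (`m ≥ 1`): genus theory of the order of conductor `3m` — `−3 ≡ 1 (mod 4)`, `|−3| ∣ 3m` — a tree THEOREM
(`sqrt_intCast_mem_ringClassField`, Cohn 1985 Thm. 2.2.23 ∕ Cox 2013 §9.A). [cite: Cox2013, §9.A] -/
theorem sqrt_negThree_mem (hK : IsImaginaryQuadratic K) (ι : K →+* ℂ) {m : ℕ} (hm : m ≠ 0) (r : ℂ) (hr : r ^ 2 = -3) :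
    r ∈ ringClassField K ι (3 * m) :=
  sqrt_intCast_mem_ringClassField hK ι (d := -3) (by decide) (mul_ne_zero three_ne_zero hm) (by simp) r
    (by rw [hr]; norm_num)

/-- **`√−3 ∉ K[m]`** for `3 ∤ m`, `3 ∤ d_K` (`m ≥ 1`): `3` ramifies in `K(√−3)` but not in `K[m]` (`sqrt_intCast_not_mem_ringClassField`,
Cox 2013 §9.A + Prop. 5.16). [cite: Cox2013, §9.A, §5.B Prop. 5.16] -/
theorem sqrt_negThree_not_mem (hK : IsImaginaryQuadratic K) (ι : K →+* ℂ) {m : ℕ} (hm : m ≠ 0) (h3m : ¬ 3 ∣ m)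
    (h3D : ¬ (3 : ℤ) ∣ NumberField.discr K) (r : ℂ) (hr : r ^ 2 = -3) : r ∉ ringClassField K ι m :=
  sqrt_intCast_not_mem_ringClassField hK ι hm Nat.prime_three (d := -3) (by norm_num) (by norm_num) h3m
    (by exact_mod_cast h3D) r (by rw [hr]; norm_num)

/-! ## §2 `#Gal(K[3m]/K[m]) = 2` -/

/-- **`#Gal(K[3m]/K[m]) = 2`** for `3` split in `K`, `3 ∤ m`, `m ≥ 1`, `d_K < −4`: the Galois correspondence
(`card_ringClassGalOver_eq_finrank_subfieldIn`) and `[K[3m] : K[m]] = 3 − (d_K/3) = 2` (`finrank_subfieldIn_prime_mul_of_split`, Cox Cor. 7.28).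
[cite: Cox2013, §7.D Thm. 7.24 and Cor. 7.28, §9.A] [cite: GrossLMS1991, §3 (PDF p. 216, field diagram)] -/
theorem card_ringClassGalOver_three_mul (hK : IsImaginaryQuadratic K) (ι : K →+* ℂ) {m : ℕ} (hm : m ≠ 0) (h3m : ¬ 3 ∣ m)
    (hsplit : ((Ideal.span {((3 : ℕ) : ℤ)}).primesOver (𝓞 K)).ncard = 2) (hD : NumberField.discr K < -4) :
    Nat.card (ringClassGalOver ι (3 * m) m) = 2 := by
  have hcop : Nat.Coprime 3 m := (Nat.Prime.coprime_iff_not_dvd Nat.prime_three).mpr h3m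
  rw [card_ringClassGalOver_eq_finrank_subfieldIn hK ι m (mul_ne_zero three_ne_zero hm),
    finrank_subfieldIn_prime_mul_of_split hK ι Nat.prime_three hsplit hcop (Or.inr hD)]

/-! ## §3 The genus involution -/

/-- **The genus involution `σ_m`.** For `3` split in `K`, `3 ∤ m`, `m ≥ 1`, `d_K < −4`, `3 ∤ d_K`: there is `σ ∈ Gal(K[3m]/K[m])` with
`σ θ = −θ` for EVERY `θ ∈ K[3m]` with `θ² = −3`, `σ * σ = 1`, and every element of `Gal(K[3m]/K[m])` is `1` or `σ`
(`K[3m] = K[m](√−3)`: the group has order `2` by §2, and it cannot fix `√−3 ∉ K[m]` by the Galois correspondence for `K[3m]/K`,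
`IsGalois.fixedField_fixingSubgroup`). [cite: Cox2013, §9.A] [cite: CoatesLiTianZhai2015, Lemma 2.7] -/
theorem exists_genusInvolution (hK : IsImaginaryQuadratic K) (ι : K →+* ℂ) {m : ℕ} (hm : m ≠ 0) (h3m : ¬ 3 ∣ m)
    (hsplit : ((Ideal.span {((3 : ℕ) : ℤ)}).primesOver (𝓞 K)).ncard = 2) (hD : NumberField.discr K < -4)
    (h3D : ¬ (3 : ℤ) ∣ NumberField.discr K) :
    ∃ σ : ringClassField K ι (3 * m) ≃ₐ[ℚ] ringClassField K ι (3 * m), σ ∈ ringClassGalOver ι (3 * m) m ∧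
      (∀ θ : ringClassField K ι (3 * m), θ ^ 2 = algebraMap ℚ (ringClassField K ι (3 * m)) (-3) → σ θ = -θ) ∧
      σ * σ = 1 ∧
      ∀ τ ∈ ringClassGalOver ι (3 * m) m, τ = 1 ∨ τ = σ := by
  have hn : 3 * m ≠ 0 := mul_ne_zero three_ne_zero hm
  letI : Algebra K ℂ := ι.toAlgebra
  haveI := (finiteDimensional_and_isGalois_ringClassField hK ι hn).1
  haveI := (finiteDimensional_and_isGalois_ringClassField hK ι hn).2
  have hcard := card_ringClassGalOver_three_mul hK ι hm h3m hsplit hD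
  -- a square root of `−3` in `K[3m]`
  set r : ℂ := Complex.I * (Real.sqrt 3 : ℂ) with hr_def
  have hr : r ^ 2 = -3 := by
    rw [hr_def, mul_pow, Complex.I_sq, ← Complex.ofReal_pow, Real.sq_sqrt (by norm_num)]; push_cast; ring
  let θ₀ : ringClassField K ι (3 * m) := ⟨r, sqrt_negThree_mem hK ι hm r hr⟩
  have hθ₀2 : θ₀ ^ 2 = algebraMap ℚ (ringClassField K ι (3 * m)) (-3) := Subtype.ext (by
    change (r : ℂ) ^ 2 = ((algebraMap ℚ (ringClassField K ι (3 * m)) (-3) : ringClassField K ι (3 * m)) : ℂ)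
    rw [hr]
    change (-3 : ℂ) = (((-3 : ℚ) : ringClassField K ι (3 * m)) : ℂ)
    push_cast; rfl)
  -- some element of `Gal(K[3m]/K[m])` moves `θ₀` (else `θ₀ ∈ K[m]` by the Galois correspondence)
  have hmove : ∃ σ ∈ ringClassGalOver ι (3 * m) m, σ θ₀ ≠ θ₀ := by
    by_contra hall
    simp only [not_exists, not_and, not_not] at hall
    apply sqrt_negThree_not_mem hK ι hm h3m h3D r hr
    -- `θ₀` is fixed by the fixing subgroup of `F := K[3m] ∩ K[m]`, hence lies in `F`
    set F : IntermediateField K (ringClassField K ι (3 * m)) := subfieldIn ι (3 * m) m with hF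
    have hfix : ∀ g : F.fixingSubgroup, (g : ringClassField K ι (3 * m) ≃ₐ[K] ringClassField K ι (3 * m)) θ₀ = θ₀ := by
      rintro ⟨g, hg⟩
      rw [IntermediateField.mem_fixingSubgroup_iff] at hg
      have hgℚ : ∀ q : ℚ, g (algebraMap ℚ (ringClassField K ι (3 * m)) q) = algebraMap ℚ (ringClassField K ι (3 * m)) q :=
        fun q => by rw [eq_ratCast (algebraMap ℚ (ringClassField K ι (3 * m))) q, map_ratCast]
      let g' : ringClassField K ι (3 * m) ≃ₐ[ℚ] ringClassField K ι (3 * m) := { g with commutes' := hgℚ }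
      have hg' : g' ∈ ringClassGalOver ι (3 * m) m :=
        (_root_.mem_fixingSubgroup_iff (M := ringClassField K ι (3 * m) ≃ₐ[ℚ] ringClassField K ι (3 * m))).mpr
          fun y hy => hg y ((mem_subfieldIn_iff ι (3 * m) m y).mpr hy)
      exact hall g' hg'
    have hθF : θ₀ ∈ IntermediateField.fixedField F.fixingSubgroup := fun g => hfix g
    rw [IsGalois.fixedField_fixingSubgroup] at hθF
    exact (mem_subfieldIn_iff ι (3 * m) m θ₀).mp hθF
  obtain ⟨σ, hσ, hσθ₀⟩ := hmove
  have hσne : σ ≠ 1 := by rintro rfl; exact hσθ₀ rfl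
  -- the group `{1, σ}`
  have htwo : ∀ τ ∈ ringClassGalOver ι (3 * m) m, τ = 1 ∨ τ = σ := by
    intro τ hτ
    by_contra hne
    obtain ⟨hne1, hneσ⟩ := not_or.mp hne
    haveI : Finite (ringClassGalOver ι (3 * m) m) := Nat.finite_of_card_ne_zero (by rw [hcard]; decide)
    haveI : Fintype (ringClassGalOver ι (3 * m) m) := Fintype.ofFinite _
    have hsub : ({⟨1, Subgroup.one_mem _⟩, ⟨σ, hσ⟩, ⟨τ, hτ⟩} : Finset (ringClassGalOver ι (3 * m) m)).card = 3 := by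
      rw [Finset.card_insert_of_notMem, Finset.card_insert_of_notMem, Finset.card_singleton]
      · simp only [Finset.mem_singleton, Subtype.mk.injEq]; exact fun h => hneσ h.symm
      · simp only [Finset.mem_insert, Finset.mem_singleton, Subtype.mk.injEq, not_or]
        exact ⟨fun h => hσne h.symm, fun h => hne1 h.symm⟩
    have h3 := Finset.card_le_univ ({⟨1, Subgroup.one_mem _⟩, ⟨σ, hσ⟩, ⟨τ, hτ⟩} : Finset (ringClassGalOver ι (3 * m) m))
    rw [hsub, ← Nat.card_eq_fintype_card, hcard] at h3
    omega
  have hσσ : σ * σ = 1 := by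
    rcases htwo (σ * σ) (Subgroup.mul_mem _ hσ hσ) with h | h
    · exact h
    · exact absurd (mul_left_cancel (a := σ) (h.trans (mul_one σ).symm)) hσne
  refine ⟨σ, hσ, fun θ hθ2 => ?_, hσσ, htwo⟩
  -- `σ` negates EVERY square root of `−3` (it negates `θ₀ = ±θ`)
  rcases algEquiv_apply_eq_or_eq_neg_of_sq_eq hθ₀2 σ with h | h
  · exact absurd h hσθ₀
  · have hθθ : θ = θ₀ ∨ θ = -θ₀ := by
      apply sq_eq_sq_iff_eq_or_eq_neg.mp; rw [hθ2, hθ₀2]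
    rcases hθθ with rfl | rfl
    · exact h
    · rw [map_neg, h, neg_neg]

/-! ## §4 The level-`m` descent -/

section Descent

variable (W : WeierstrassCurve ℚ) {W₁ : WeierstrassCurve ℚ} [W₁.IsCharNeTwoNF] (C₁ : VariableChange ℚ) (hC₁ : C₁ • W = W₁)
  {V : WeierstrassCurve ℚ} (CV : VariableChange ℚ) (hV : CV • W₁.quadraticTwist (-3) = V)

omit [W₁.IsCharNeTwoNF] in
/-- Reading the structure map of an algebra GIVEN by a `K`-algebra map `f : k → E` on points: `Point.map (algebraMap k E) = Point.map f`
(stated for abstract fields — a `rfl` on coordinates; kept generic so that no concrete ring class field is unfolded). [folklore] -/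
theorem map_toRatAlgHom_eq_map_restrictScalars {k E : Type} [Field k] [CharZero k] [Field E] [CharZero E] [Algebra K k] [Algebra K E]
    (f : k →ₐ[K] E) (P : (W.baseChange k).toAffine.Point) :
    letI : Algebra k E := f.toRingHom.toAlgebra
    Affine.Point.map (algebraMap k E).toRatAlgHom P = Affine.Point.map (f.restrictScalars ℚ) P := by
  letI : Algebra k E := f.toRingHom.toAlgebra
  rcases P with _ | ⟨x, y, h⟩ <;> rfl

/-- **The level-`m` descent `D_m`.** Let `K[m] ≤ K[3m]` (`hle`), `σ ∈ Gal(K[3m]/K[m])` with `σ * σ = 1` negating `θ ∈ K[3m]`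
(`θ² = −3`) and `Gal(K[3m]/K[m]) = {1, σ}` (§3), and `y ∈ V(K[3m])`. Then `z := y − σ·y` is fixed by `1` and negated by `σ`, so
`ψ_θ(z) ∈ W(K[3m])` is fixed by `Gal(K[3m]/K[m])` (part 10) and DESCENDS: there is `D ∈ W(K[m])` with `D↑K[3m] = ψ_θ(y − σ·y)`
(the inclusion `K[m] → K[3m]` read on points). On the line: `y = y(3m)` the conductor-`3m` CM point of `V`, `D = D_m`, and
`ys(m) = c·χ₋₃(m)·D_m` is the labelled `W`-family of (DISPLAY-L). [cite: SilvermanAEC2009, X.5 Cor. 5.4 (iii), VIII.§1]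
[cite: GrossLMS1991, §3 (the tower K[m] ⊂ K[3m])] -/
theorem exists_genusDescent_level (hK : IsImaginaryQuadratic K) (ι : K →+* ℂ) {m : ℕ} (hm : m ≠ 0)
    (hle : ringClassField K ι m ≤ ringClassField K ι (3 * m))
    {σ : ringClassField K ι (3 * m) ≃ₐ[ℚ] ringClassField K ι (3 * m)} (hσσ : σ * σ = 1)
    (htwo : ∀ τ ∈ ringClassGalOver ι (3 * m) m, τ = 1 ∨ τ = σ)
    {θ : ringClassField K ι (3 * m)} (hθ2 : θ ^ 2 = algebraMap ℚ (ringClassField K ι (3 * m)) (-3)) (hσθ : σ θ = -θ)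
    (y : (V.baseChange (ringClassField K ι (3 * m))).toAffine.Point) :
    ∃ D : (W.baseChange (ringClassField K ι m)).toAffine.Point,
      Affine.Point.map ((RingClassField.inclusion ι hle).restrictScalars ℚ) D =
        genusTransport W C₁ hC₁ CV hV hθ2 (y - pointGalHom V (ringClassField K ι (3 * m)) σ y) := by
  have hn : 3 * m ≠ 0 := mul_ne_zero three_ne_zero hm
  letI : Algebra K ℂ := ι.toAlgebra
  haveI := (finiteDimensional_and_isGalois_ringClassField hK ι hn).1
  haveI := (finiteDimensional_and_isGalois_ringClassField hK ι hn).2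
  haveI := (finiteDimensional_and_isGalois_ringClassField hK ι hm).1
  -- `K[3m]` as a `K[m]`-algebra through the inclusion; Galois over `K[m]` (top of the Galois tower `K ⊂ K[m] ⊂ K[3m]`)
  let incl : ringClassField K ι m →ₐ[K] ringClassField K ι (3 * m) := RingClassField.inclusion ι hle
  letI : Algebra (ringClassField K ι m) (ringClassField K ι (3 * m)) := incl.toRingHom.toAlgebra
  haveI : IsScalarTower K (ringClassField K ι m) (ringClassField K ι (3 * m)) :=
    IsScalarTower.of_algebraMap_eq fun k => (incl.commutes k).symm
  haveI : IsGalois (ringClassField K ι m) (ringClassField K ι (3 * m)) :=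
    IsGalois.tower_top_of_isGalois K (ringClassField K ι m) (ringClassField K ι (3 * m))
  have halg : ∀ x : ringClassField K ι m, algebraMap (ringClassField K ι m) (ringClassField K ι (3 * m)) x = incl x :=
    fun _ => rfl
  have hθ : θ ≠ -θ := ne_neg_of_ne_zero (theta_ne_zero hθ2)
  -- every `K[m]`-automorphism of `K[3m]`, read over `ℚ`, lies in `Gal(K[3m]/K[m])`, hence is `1` or `σ`
  have hmem : ∀ τ : ringClassField K ι (3 * m) ≃ₐ[ringClassField K ι m] ringClassField K ι (3 * m),
      (τ.restrictScalars ℚ : ringClassField K ι (3 * m) ≃ₐ[ℚ] ringClassField K ι (3 * m)) ∈ ringClassGalOver ι (3 * m) m := by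
    intro τ
    refine (_root_.mem_fixingSubgroup_iff (M := ringClassField K ι (3 * m) ≃ₐ[ℚ] ringClassField K ι (3 * m))).mpr
      fun x hx => ?_
    have hx' : x = incl ⟨(x : ℂ), hx⟩ := Subtype.ext (by rw [RingClassField.coe_inclusion])
    change τ x = x
    rw [hx', ← halg]
    exact τ.commutes _
  set z : (V.baseChange (ringClassField K ι (3 * m))).toAffine.Point := y - pointGalHom V (ringClassField K ι (3 * m)) σ y with hz
  have hσσy : pointGalHom V (ringClassField K ι (3 * m)) σ (pointGalHom V (ringClassField K ι (3 * m)) σ y) = y := by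
    have h1 : pointGalHom V (ringClassField K ι (3 * m)) σ (pointGalHom V (ringClassField K ι (3 * m)) σ y) =
        pointGalHom V (ringClassField K ι (3 * m)) (σ * σ) y := by rw [map_mul]; rfl
    rw [h1, hσσ, map_one]; rfl
  have hσz : pointGalHom V (ringClassField K ι (3 * m)) σ z = -z := by
    rw [hz, map_sub, hσσy, neg_sub]
  obtain ⟨D, hD⟩ := exists_point_map_eq_genusTransport W C₁ hC₁ CV hV hθ2 z (k := ringClassField K ι m)
    (fun τ hτ => by
      rcases htwo _ (hmem τ) with h1 | hσ'
      · have h2 : pointGalHom V (ringClassField K ι (3 * m)) (τ.restrictScalars ℚ) z = z := by rw [h1, map_one]; rfl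
        rw [pointGalHom_restrictScalars V τ z] at h2
        -- `convert`: part 10's statement carries the classical `DecidableEq` instance on the point group
        convert h2
      · exfalso
        have h2 : σ θ = θ := by rw [← hσ']; exact hτ
        exact hθ (h2.symm.trans hσθ))
    (fun τ hτ => by
      rcases htwo _ (hmem τ) with h1 | hσ'
      · exfalso
        have h2 : τ θ = θ := by
          change (τ.restrictScalars ℚ : ringClassField K ι (3 * m) ≃ₐ[ℚ] ringClassField K ι (3 * m)) θ = θ
          rw [h1]; rfl
        exact hθ (h2.symm.trans hτ)
      · have h2 : pointGalHom V (ringClassField K ι (3 * m)) (τ.restrictScalars ℚ) z = -z := by rw [hσ', hσz]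
        rw [pointGalHom_restrictScalars V τ z] at h2
        convert h2)
  exact ⟨D, by rw [← hD]; exact (map_toRatAlgHom_eq_map_restrictScalars W incl D).symm⟩

end Descent

end Summit.BirchSwinnertonDyer.BirchSwinnertonDyer.Theorems.LeafPartnerGenusLevel

end
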